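import Summits.ValiantsHypothesis.ValiantsHypothesis.Theorems.CommutativityDial
import Literature.Computability.AlgebraicComplexity.SyntacticMultilinearAppend
import HarnessLib

/-!
# Monomial supports of noncommutative circuit values and the syntactic variable sets (kernel)

Decomposition workshop `decomp-valiant`, lens 6 «restricted-models lifting axis», gen 4, move K5c of
the node `CommutativityDial` (support file 1/3 for the kernel proof of HWY10 Thm 1.12 in
`Theorems.ApLowerBound`).

Contents: the MONOMIAL SUPPORT `supp f` of a free-algebra element (words with nonzero coefficient,
read through `FreeAlgebra.equivMonoidAlgebraFreeMonoid`) and its behaviour under `+, •, *, ι,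
algebraMap` (§1); accessors for the value list `CommutativityDial.ncGateValues` and the tree's
variable-set list `gateVarSets` (§2); the LETTER SET `vars f` and the SUPPORT DISCIPLINE
`vars_ncGateValues`: every letter of every support word of the `j`-th gate value of a noncommutative
circuit lies in the `j`-th syntactic variable set `X_j` (§3) — the noncommutative reading of
Raz–Yehudayoff's remark that `Φ_v` is a polynomial in the variables `X_v`.

HONEST FRAMING: bookkeeping only; nothing here bears on `VP ≠ VNP`.

## References
* [RazYehudayoff2008] R. Raz, A. Yehudayoff, Lower bounds and separations for constant depth
  multilinear circuits, CCC 2008, §2.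
* [HrubesWigdersonYehudayoff2010] P. Hrubeš, A. Wigderson, A. Yehudayoff, Relationless completeness and
  separations, CCC 2010 / ECCC TR10-021, §F.2.
-/

namespace Summit.ValiantsHypothesis.ValiantsHypothesis.Theorems.NcSupport

open Literature.Computability.AlgebraicComplexity
open Literature.Computability.AlgebraicComplexity.ArithCircuit hiding ncGateValues ncEval ncGateValues_append_singleton
open Summit.ValiantsHypothesis.ValiantsHypothesis.Theorems.CommutativityDial
open scoped Pointwise

universe u v

section Support

variable {R : Type u} [CommSemiring R] {σ : Type v}

/-! ## §1 Monomial support and letters in the free algebra -/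

/-- The MONOMIAL SUPPORT of a free-algebra element: the words with nonzero coefficient (read through
`FreeAlgebra.equivMonoidAlgebraFreeMonoid`). [cite: HrubesWigdersonYehudayoff2010, §2] -/
noncomputable def supp (f : FreeAlgebra R σ) : Finset (FreeMonoid σ) :=
  (FreeAlgebra.equivMonoidAlgebraFreeMonoid f).coeff.support

/-- Support of a sum. [folklore] -/
theorem supp_add (f g : FreeAlgebra R σ) {w : FreeMonoid σ} (hw : w ∈ supp (f + g)) :
    w ∈ supp f ∨ w ∈ supp g := by
  classical
  unfold supp at hw ⊢
  rw [map_add, MonoidAlgebra.coeff_add] at hw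
  exact Finset.mem_union.1 (Finsupp.support_add hw)

/-- Support of a scalar multiple. [folklore] -/
theorem supp_smul (c : R) (f : FreeAlgebra R σ) : supp (c • f) ⊆ supp f := by
  unfold supp
  rw [map_smul, MonoidAlgebra.coeff_smul]
  exact Finsupp.support_smul

/-- Support of a product: products of support words. [folklore] -/
theorem supp_mul (f g : FreeAlgebra R σ) {w : FreeMonoid σ} (hw : w ∈ supp (f * g)) :
    ∃ a ∈ supp f, ∃ b ∈ supp g, a * b = w := by
  classical
  unfold supp at hw ⊢
  rw [map_mul] at hw
  exact Finset.mem_mul.1 (MonoidAlgebra.support_coeff_mul_subset _ _ hw)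

/-- Support of zero. [folklore] -/
theorem supp_zero : supp (0 : FreeAlgebra R σ) = ∅ := by
  simp [supp]

/-- Support of a generator. [folklore] -/
theorem supp_ι (x : σ) : supp (FreeAlgebra.ι R x) ⊆ {FreeMonoid.of x} := by
  unfold supp
  have : FreeAlgebra.equivMonoidAlgebraFreeMonoid (FreeAlgebra.ι R x) =
      MonoidAlgebra.single (FreeMonoid.of x) (1 : R) := by
    simp [FreeAlgebra.equivMonoidAlgebraFreeMonoid, MonoidAlgebra.of_apply]
  rw [this, MonoidAlgebra.coeff_single]
  exact Finsupp.support_single_subset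

/-- Support of a scalar. [folklore] -/
theorem supp_algebraMap (c : R) : supp (algebraMap R (FreeAlgebra R σ) c) ⊆ {1} := by
  unfold supp
  rw [AlgEquiv.commutes, MonoidAlgebra.coe_algebraMap, Function.comp_apply, MonoidAlgebra.coeff_single]
  exact Finsupp.support_single_subset

/-- Support of a list sum: some summand. [folklore] -/
theorem exists_of_mem_supp_sum (l : List (FreeAlgebra R σ)) {w : FreeMonoid σ} (hw : w ∈ supp l.sum) :
    ∃ f ∈ l, w ∈ supp f := by
  induction l with
  | nil => simp [supp_zero] at hw
  | cons f l ih =>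
    rw [List.sum_cons] at hw
    rcases supp_add _ _ hw with h | h
    · exact ⟨f, by simp, h⟩
    · obtain ⟨g, hg, hwg⟩ := ih h
      exact ⟨g, by simp [hg], hwg⟩

/-! ## §2 Support discipline of noncommutative circuits -/

/-- Words of an operand value: a variable gives the one-letter word, a constant the empty word, a gate
reference a word of that gate's value (junk `0` beyond the list). [folklore] -/
theorem mem_supp_ncOperandEval {vals : List (FreeAlgebra R σ)} {u : Operand R σ} {w : FreeMonoid σ}
    (hw : w ∈ supp (ncOperandEval vals u)) :
    (∃ x, u = .var x ∧ w = FreeMonoid.of x) ∨ (∃ c, u = .const c ∧ w = 1) ∨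
      (∃ j, u = .gate j ∧ j < vals.length ∧ w ∈ supp (vals.getD j 0)) := by
  cases u with
  | var x => exact Or.inl ⟨x, rfl, Finset.mem_singleton.1 (supp_ι x hw)⟩
  | const c => exact Or.inr (Or.inl ⟨c, rfl, Finset.mem_singleton.1 (supp_algebraMap c hw)⟩)
  | gate j =>
    refine Or.inr (Or.inr ⟨j, rfl, ?_, hw⟩)
    by_contra hj
    rw [not_lt] at hj
    have : ncOperandEval vals (.gate j : Operand R σ) = 0 := by
      rw [ncOperandEval, List.getD_eq_getElem?_getD, List.getElem?_eq_none hj, Option.getD_none]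
    rw [this, supp_zero] at hw
    simp at hw

/-- The length of `ncGateValues`. [folklore] -/
theorem length_ncGateValues (gs : List (Gate R σ)) : (ncGateValues gs).length = gs.length := by
  induction gs using List.reverseRecOn with
  | nil => rfl
  | append_singleton gs g ih => simp [ih]

/-- Values of a prefix are a prefix of the values. [folklore] -/
theorem ncGateValues_getD_append (gs gs' : List (Gate R σ)) {i : ℕ} (hi : i < gs.length) :
    (ncGateValues (gs ++ gs')).getD i 0 = (ncGateValues gs).getD i 0 := by
  induction gs' using List.reverseRecOn with
  | nil => simp
  | append_singleton gs' g ih =>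
    rw [← List.append_assoc, ncGateValues_append_singleton, List.getD_eq_getElem?_getD,
      List.getElem?_append_left (by rw [length_ncGateValues, List.length_append]; omega),
      ← List.getD_eq_getElem?_getD, ih]

/-- The value list of `gs ++ [g]` at position `gs.length` is the value of `g`. [folklore] -/
theorem ncGateValues_getD_length (gs : List (Gate R σ)) (g : Gate R σ) :
    (ncGateValues (gs ++ [g])).getD gs.length 0 = ncGateEval (ncGateValues gs) g := by
  rw [ncGateValues_append_singleton, List.getD_eq_getElem?_getD, ← length_ncGateValues gs,
    List.getElem?_append_right le_rfl, Nat.sub_self]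
  rfl

/-- Beyond the list the value is the junk `0`. [folklore] -/
theorem ncGateValues_getD_of_le (gs : List (Gate R σ)) {i : ℕ} (hi : gs.length ≤ i) :
    (ncGateValues gs).getD i 0 = 0 := by
  rw [List.getD_eq_getElem?_getD, List.getElem?_eq_none (by rw [length_ncGateValues]; exact hi)]
  rfl

variable [DecidableEq σ]

/-- The set of LETTERS of a word. [cite: HrubesWigdersonYehudayoff2010, §2] -/
noncomputable def letters (w : FreeMonoid σ) : Finset σ := (FreeMonoid.toList w).toFinset

/-- Letters of a product. [folklore] -/
theorem letters_mul (a b : FreeMonoid σ) : letters (a * b) = letters a ∪ letters b := by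
  simp [letters, FreeMonoid.toList_mul, List.toFinset_append]

omit [CommSemiring R] in
/-- The length of `gateVarSets`. [cite: RazYehudayoff2008, §2] -/
theorem length_gateVarSets (gs : List (Gate R σ)) : (gateVarSets gs).length = gs.length :=
  (SmAppend.gateVarSets_append_singleton_and_length gs).2

omit [CommSemiring R] in
/-- Variable sets of a prefix are a prefix of the variable sets. [cite: RazYehudayoff2008, §2] -/
theorem gateVarSets_getD_append (gs gs' : List (Gate R σ)) {i : ℕ} (hi : i < gs.length) :
    (gateVarSets (gs ++ gs')).getD i ∅ = (gateVarSets gs).getD i ∅ := by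
  induction gs' using List.reverseRecOn with
  | nil => simp
  | append_singleton gs' g ih =>
    rw [← List.append_assoc, (SmAppend.gateVarSets_append_singleton_and_length _).1,
      List.getD_eq_getElem?_getD,
      List.getElem?_append_left (by rw [length_gateVarSets, List.length_append]; omega),
      ← List.getD_eq_getElem?_getD, ih]

omit [CommSemiring R] in
/-- `gateVarSets` of a `take`-prefix agrees with the full list below the cut. [cite: RazYehudayoff2008, §2] -/
theorem gateVarSets_take_getD (gs : List (Gate R σ)) {i j : ℕ} (hj : j < i) (hi : i ≤ gs.length) :
    (gateVarSets (gs.take i)).getD j ∅ = (gateVarSets gs).getD j ∅ := by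
  conv_rhs => rw [← List.take_append_drop i gs]
  rw [gateVarSets_getD_append _ _ (by rw [List.length_take]; omega)]

omit [CommSemiring R] in
/-- An operand's variable set lies inside the variable set of any gate using it. [cite: RazYehudayoff2008, §2] -/
theorem operandVarSet_subset_gateVarSet (vs : List (Finset σ)) (g : Gate R σ) {u : Operand R σ}
    (hu : u ∈ g.args) : operandVarSet vs u ⊆ gateVarSet vs g := by
  unfold gateVarSet
  generalize g.args = l at hu
  induction l with
  | nil => simp at hu
  | cons a l ih =>
    rw [List.map_cons, List.foldr_cons]
    rcases List.mem_cons.1 hu with rfl | h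
    · exact Finset.subset_union_left
    · exact (ih h).trans Finset.subset_union_right

omit [CommSemiring R] in
/-- The variable-set list of `gs ++ [g]` at position `gs.length` is the variable set of `g`.
[cite: RazYehudayoff2008, §2] -/
theorem gateVarSets_getD_length (gs : List (Gate R σ)) (g : Gate R σ) :
    (gateVarSets (gs ++ [g])).getD gs.length ∅ = gateVarSet (gateVarSets gs) g := by
  rw [(SmAppend.gateVarSets_append_singleton_and_length gs).1, List.getD_eq_getElem?_getD,
    ← length_gateVarSets gs, List.getElem?_append_right le_rfl, Nat.sub_self]
  rfl

/-! ## §3 Letters of gate values stay inside the syntactic variable sets -/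

/-- The set of letters occurring in (some support word of) a free-algebra element.
[cite: HrubesWigdersonYehudayoff2010, §F.2] -/
noncomputable def vars (f : FreeAlgebra R σ) : Finset σ := (supp f).biUnion letters

/-- A support word's letters are among the element's letters. [folklore] -/
theorem letters_subset_vars {f : FreeAlgebra R σ} {w : FreeMonoid σ} (hw : w ∈ supp f) :
    letters w ⊆ vars f :=
  Finset.subset_biUnion_of_mem letters hw

/-- `vars f ⊆ W` unfolded. [folklore] -/
theorem vars_subset_iff {f : FreeAlgebra R σ} {W : Finset σ} :
    vars f ⊆ W ↔ ∀ w ∈ supp f, letters w ⊆ W :=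
  Finset.biUnion_subset

/-- Letters of a sum. [folklore] -/
theorem vars_add (f g : FreeAlgebra R σ) : vars (f + g) ⊆ vars f ∪ vars g := by
  rw [vars_subset_iff]
  intro w hw
  rcases supp_add f g hw with h | h
  · exact (letters_subset_vars h).trans Finset.subset_union_left
  · exact (letters_subset_vars h).trans Finset.subset_union_right

/-- Letters of a scalar multiple. [folklore] -/
theorem vars_smul (c : R) (f : FreeAlgebra R σ) : vars (c • f) ⊆ vars f := by
  rw [vars_subset_iff]
  exact fun w hw => letters_subset_vars (supp_smul c f hw)

/-- Letters of a product. [folklore] -/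
theorem vars_mul (f g : FreeAlgebra R σ) : vars (f * g) ⊆ vars f ∪ vars g := by
  rw [vars_subset_iff]
  intro w hw
  obtain ⟨a, ha, b, hb, rfl⟩ := supp_mul f g hw
  rw [letters_mul]
  exact Finset.union_subset_union (letters_subset_vars ha) (letters_subset_vars hb)

/-- Letters of zero. [folklore] -/
theorem vars_zero : vars (0 : FreeAlgebra R σ) = ∅ := by
  simp [vars, supp_zero]

/-- Letters of a generator. [folklore] -/
theorem vars_ι (x : σ) : vars (FreeAlgebra.ι R x) ⊆ {x} := by
  rw [vars_subset_iff]
  intro w hw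
  rw [Finset.mem_singleton.1 (supp_ι x hw)]
  simp [letters]

/-- Letters of a scalar: none. [folklore] -/
theorem vars_algebraMap (c : R) : vars (algebraMap R (FreeAlgebra R σ) c) = ∅ := by
  rw [← Finset.subset_empty, vars_subset_iff]
  intro w hw
  rw [Finset.mem_singleton.1 (supp_algebraMap c hw)]
  simp [letters]

/-- Letters of one: none. [folklore] -/
theorem vars_one : vars (1 : FreeAlgebra R σ) = ∅ := by
  rw [← map_one (algebraMap R (FreeAlgebra R σ))]
  exact vars_algebraMap 1

/-- Letters of a list sum. [folklore] -/
theorem vars_list_sum (l : List (FreeAlgebra R σ)) (W : Finset σ) (h : ∀ f ∈ l, vars f ⊆ W) :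
    vars l.sum ⊆ W := by
  induction l with
  | nil => simp [vars_zero]
  | cons f l ih =>
    rw [List.sum_cons]
    exact (vars_add _ _).trans
      (Finset.union_subset (h f (by simp)) (ih fun g hg => h g (by simp [hg])))

/-- Letters of a list product. [folklore] -/
theorem vars_list_prod (l : List (FreeAlgebra R σ)) (W : Finset σ) (h : ∀ f ∈ l, vars f ⊆ W) :
    vars l.prod ⊆ W := by
  induction l with
  | nil => simp [vars_one]
  | cons f l ih =>
    rw [List.prod_cons]
    exact (vars_mul _ _).trans
      (Finset.union_subset (h f (by simp)) (ih fun g hg => h g (by simp [hg])))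

/-- Letters of an operand value lie in the operand's syntactic variable set, given the same for the
gate values it may reference. [cite: RazYehudayoff2008, §2] -/
theorem vars_ncOperandEval {vals : List (FreeAlgebra R σ)} {vs : List (Finset σ)}
    (hV : ∀ j, vars (vals.getD j 0) ⊆ vs.getD j ∅) (u : Operand R σ) :
    vars (ncOperandEval vals u) ⊆ operandVarSet vs u := by
  cases u with
  | var x => exact vars_ι x
  | const c => simp [ncOperandEval, vars_algebraMap, operandVarSet]
  | gate j => exact hV j

/-- Letters of a gate value lie in the gate's syntactic variable set, given the same for the gate
values it may reference. [cite: RazYehudayoff2008, §2] -/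
theorem vars_ncGateEval {vals : List (FreeAlgebra R σ)} {vs : List (Finset σ)}
    (hV : ∀ j, vars (vals.getD j 0) ⊆ vs.getD j ∅) (g : Gate R σ) :
    vars (ncGateEval vals g) ⊆ gateVarSet vs g := by
  cases g with
  | sum args =>
    refine vars_list_sum _ _ fun f hf => ?_
    obtain ⟨⟨c, u⟩, hcu, rfl⟩ := List.mem_map.1 hf
    exact (vars_smul _ _).trans ((vars_ncOperandEval hV u).trans
      (operandVarSet_subset_gateVarSet vs (.sum args) (List.mem_map_of_mem (f := Prod.snd) hcu)))
  | prod args =>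
    refine vars_list_prod _ _ fun f hf => ?_
    obtain ⟨u, hu, rfl⟩ := List.mem_map.1 hf
    exact (vars_ncOperandEval hV u).trans (operandVarSet_subset_gateVarSet vs (.prod args) hu)

/-- **Support discipline**: every letter of (every support word of) the `j`-th gate value lies in the
`j`-th syntactic variable set. [cite: RazYehudayoff2008, §2] -/
theorem vars_ncGateValues (gs : List (Gate R σ)) :
    ∀ j, vars ((ncGateValues gs).getD j 0) ⊆ (gateVarSets gs).getD j ∅ := by
  induction gs using List.reverseRecOn with
  | nil => intro j; simp [ncGateValues, vars_zero]
  | append_singleton gs g ih =>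
    intro j
    rcases lt_trichotomy j gs.length with hj | rfl | hj
    · rw [ncGateValues_getD_append gs [g] hj, gateVarSets_getD_append gs [g] hj]
      exact ih j
    · rw [ncGateValues_getD_length, gateVarSets_getD_length]
      exact vars_ncGateEval ih g
    · rw [ncGateValues_getD_of_le _ (by rw [List.length_append, List.length_singleton]; omega),
        vars_zero]
      exact Finset.empty_subset _

/-- Letters of a support word of the `j`-th gate value lie in the `j`-th variable set.
[cite: RazYehudayoff2008, §2] -/
theorem letters_subset_of_mem_supp (gs : List (Gate R σ)) {j : ℕ} {w : FreeMonoid σ}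
    (hw : w ∈ supp ((ncGateValues gs).getD j 0)) : letters w ⊆ (gateVarSets gs).getD j ∅ :=
  (letters_subset_vars hw).trans (vars_ncGateValues gs j)

end Support

end Summit.ValiantsHypothesis.ValiantsHypothesis.Theorems.NcSupport
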